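import Mathlib
import Summits.Ventures.FusionMHD.Models.SAlphaSecondStableS3A5675Core0
import HarnessLib

/-!
# STABLE-POINT core at `(3, 227/40)`, piece 9 (`[6, 10]`): kernel-decided Taylor-model leaves ⇒ `F_9 > 0` and `amplitudeResidual 3 (227/40) F_9 F_9″ ≤ 0` on the piece ⇒ `EnergyDominatesOn` for its amplitude phase

LADDER-GRIDFUSION rung F3 («F3.BALLOON-sα-S3-SECOND-EDGE-HALVING-A5675»: the second-edge bracket at s = 3 HALVED from the stable side ([28/5, 23/4] → [28/5, 227/40]) (DIRECTOR RULING 67 (5) class / I4107 (2))); gridfusion-model-7 g10, 2026-08-28 (g8/g9 core lane).  Two `decide +kernel` calls (`OpModel.trig.pLeavesCheck`, scale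
`2^60`, Taylor degree 10, 32 leaves of half-width 1/16) and the lane's soundness theorem `OpSem.trig.pos_of_pLeavesCheck`
(Literature/Analysis/ValidatedNumerics/TaylorModelZeroCert); lit-4's `energyDominatesOn_of_amplitude` (BallooningSAlphaStableSide) turns the two
sign facts into energy domination by `amplitudePhase 3 (227/40) F_9 F_9′` on the piece.  MODELLED: `s–α` model; nothing about a device.
No `native_decide`.  Citations: Freidberg 2014 §12.6.2 (12.97) [Freidberg2014]; Makino–Berz 2003 Alg. 2 [MakinoBerz2003]; Hartman 2002 XI.6.2
[Hartman2002].  Everything here is [instance data].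
-/

open Literature.Analysis.ValidatedNumerics Literature.Analysis.ValidatedNumerics.PolyMP
open Literature.Analysis.ValidatedNumerics.NumericsMP Literature.Analysis.ValidatedNumerics.ExpPoly
open Literature.MathematicalPhysics.MHD.Ballooning
open Real Set

namespace Summit.Ventures.FusionMHD.Models

namespace SAlphaSecondStableS3A5675

/-- KERNEL CHECK (residual leaves of piece 9). [instance data] -/
theorem ss35675_res9_ok : OpModel.trig.pLeavesCheck ss35675Prm (2 ^ 60) (ss35675Prog Q9 (Poly.deriv (Poly.deriv Q9))) [] ss35675Leaves9 = true := by
  decide +kernel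

/-- KERNEL CHECK (positivity leaves of piece 9). [instance data] -/
theorem ss35675_pos9_ok : OpModel.trig.pLeavesCheck ss35675Prm (2 ^ 60) (ss35675PosProg Q9) [] ss35675Leaves9 = true := by
  decide +kernel

/-- The leaves tile `[6, 10]`. [instance data] -/
theorem ss35675_tiles9 : tiles (6 : ℚ) (ss35675Leaves9.map fun l => (l.e, l.k)) (10 : ℚ) = true := by
  decide +kernel

/-- **PIECE 9**: the phase of `F_9` dominates the `s–α` energy on `[6, 10]` at `(s, α) = (3, 227/40)`. [instance data] -/
theorem ss35675_dominates9 :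
    SAlpha.EnergyDominatesOn 3 (227 / 40) (SAlpha.amplitudePhase 3 (227 / 40) (Poly.eval Q9) (Poly.eval (Poly.deriv Q9)))
      (Icc (6 : ℝ) (10 : ℝ)) := by
  have h := ss35675_dominates (lf := Q9) (x := 6) (y := 10) (by norm_num) ss35675_tiles9 ss35675_res9_ok ss35675_pos9_ok
  norm_num at h
  exact h

end SAlphaSecondStableS3A5675

end Summit.Ventures.FusionMHD.Models
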